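import Literature.IUT.HodgeTheaters.GenuineFKitOfBadLocalSlots
import Literature.IUT.HodgeTheaters.InitialThetaDataBadLocalFrobenioidTempered
import HarnessLib

/-!
# The merge record with `m1` an [EtTh] Def. 3.6 TEMPERED FROBENIOID over the pair's `Π_{X̳̲_v̲}` + the remaining input
# (`TemperedThetaRest`): `MergeInputs.ofRest`, and [IUTchI] Example 3.2 (iii) / (vi)(d) AT THE MERGE RECORD

S. Mochizuki, *Inter-universal Teichmüller theory I*, kurims manuscript (May 2020), Example 3.2 (i) p. 70 («a tempered Frobenioid `ℱ̲_v`
… over the base category `𝒟_v`»), (iii) p. 71 («the `p_v`-adic Frobenioid constituted by the "base-field-theoretic hull" … `𝒞_v ⊆ ℱ̲_v` …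
may be reconstructed category-theoretically from `ℱ̲_v`»), (vi) (d) p. 73 («`𝒟_v` from `ℱ̲_v` [cf. [EtTh], Theorem 4.4; [EtTh], Proposition
5.1] or from `𝒞_v`») ([IUTchI] Ex 3.2 (iii) p.71) [claim: Mochizuki2012, status: disputed] (D-0012 claim key, series status DISPUTED —
compositions BY NAME; nothing of the series is asserted; no side is taken on [IUTchIII] Cor. 3.12).

PURPOSE (L5 BASE-MERGE RACE sequel, racer C; merge record `InitialThetaData.MergeInputs D B`, abc-iut-L5-t2 ★ p496697).  The hub object
(m1) «the L2 tempered Frobenioid of the Tate curve» is `TemperedThetaInput`-shaped in the record (`BadTemperedSide.Kt`).  abc-iut-L5-t2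
gen 6 (`BadLocalFrobenioidOfKitsTempered`, p444522) reduced that input to abc-iut-L2-t3's [EtTh] Def. 3.6 structure `TemperedFrobenioid T′
𝒟_v VD` plus the REMAINING input `TemperedThetaRest` (`ℱ̲_v := Fr.category`, `T_A := (A, 0)`, `𝒞_v := Fr^{bs-fld}`, `𝒞_v ⊆ ℱ̲_v := Fr.hull`,
faithful by L2's `hullFaithful_holds`).  THIS FILE records that reduction AT THE MERGE RECORD:
* `BadTemperedRest B x hx T` — the data ⟨`D₀`, `T′`, `VD`, `Fr : TemperedFrobenioid T′ (CosetCat ↥(B x hx).H) VD`, `Fbirat`, `R : TemperedThetaRest …`⟩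
  over the pair's own `Π_{X̳̲_v̲}` (weak [FrdI] monoid vocabulary `treeMonoidVocabWeak`, the one abc-iut-L1-t12's [EtTh] Cor. 3.8 (ii) closer
  is stated over); `BadTemperedRest.toSide := ⟨Fr.category, Fbirat, Fr.hullCategory, R.toInput⟩`;
* `MergeInputs.ofRest m2 Rr m4 geomTFG` — the merge record whose (m1) IS a tempered Frobenioid + rest at every bad index;
* (iii) `cFromF_frobeniusBadAt_ofRest` — «`𝒞_v` from `ℱ̲_v`» at `frobeniusBadAt B (ofRest …) x hx` modulo EXACTLY L1-t12's [EtTh] Cor. 3.8 (ii)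
  bundle {`hnd`, `hds`, `hF`, `h5`, `hR`} on `Fr` (p489650 `cFromF_badLocalFrobenioidAt_toInput` with `T := m2 x hx`);
* (vi)(d) `dFromF_frobeniusBadAt_ofRest` — «`𝒟_v` from `ℱ̲_v` / from `𝒞_v`» modulo {[FrdI] Thm. 3.4 (v) bundles `hF′`, `hC`} + {`Π_{X̳̲_v̲}` tempered
  `hP`, slim `hZ`} (p489650 `dFromF_badLocalFrobenioidAt_toInput_of_isTempered`); `…_of_isClosed` with `hP` discharged for a CLOSED avatar
  (`isTempered_badPair_of_isClosed`, p497246);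
* `ex32_iii_vi_cd_frobeniusBadAt_ofRest` — (iii) ∧ (vi)(c) ∧ (vi)(d) jointly ((vi)(c) UNCONDITIONAL by p497246).
BINDER CENSUS: {`D`, `B`, `m2`, `Rr`, `m4`, `geomTFG`, `x`, `hx`} ∪ the displayed named bundles exactly as in p489650; FACT unnamed 0; no instance,
no notation, no `sorry`.  HONEST: the reduction pins the L2 input to L2's OWN interface (`TemperedFrobenioid` is itself a data structure over
the [EtTh] §3 inputs); nothing asserts it is inhabited by the tempered Frobenioid of the actual Tate curve; typed ≠ inhabited ≠ proved.
-/

noncomputable section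

namespace Literature.IUT.HodgeTheaters

open CategoryTheory Opposite _root_.NumberField _root_.IsDedekindDomain Literature.NumberTheory.NumberFields
  Literature.AlgebraicGeometry.Frobenioids Literature.AlgebraicGeometry.Frobenioids.PadicFrd
  Literature.AnabelianGeometry.SemiGraphs Literature.AnabelianGeometry.EtaleTheta Topology

universe u₀

variable {F K Fbar : Type} [Field F] [NumberField F] [Field K] [NumberField K] [Algebra F K]
  [Field Fbar] [Algebra F Fbar] [Algebra K Fbar] {E : WeierstrassCurve F}
  [E.IsElliptic] {l : ℕ} {Pb : BadPlacePredicates K} (D : InitialThetaData F K Fbar E l Pb)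
  (B : ∀ v, v ∈ D.indexCopyBad → D.BadPairAt v)

namespace InitialThetaData

/-- **(m1) as an [EtTh] Def. 3.6 tempered Frobenioid + remaining input at a bad index**: abc-iut-L2-t3's `TemperedFrobenioid T′ 𝒟_v VD` over
`𝒟_v = CosetCat ↥(B x hx).H` (its base data `D₀`, realified divisor monoids `T′` in the weak [FrdI] vocabulary, category data `VD`), the
birationalization carrier `ℱ÷_v`, and abc-iut-L5-t2's `TemperedThetaRest` (p444522) over the group datum `T` and the genuine `q̲_v̲`.
Interface DATA of the L2 lane, never asserted. ([IUTchI] Ex 3.2 (i) p.70) [claim: Mochizuki2012, status: disputed] -/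
structure BadTemperedRest (x : D.IndexCopy) (hx : x ∈ D.indexCopyBad)
    (T : BadLocalGroupDatum (D.GalAt x (D.not_mem_arc_of_mem_bad hx)) ↥(B x hx).H) : Type (max 1 (u₀ + 1)) where
  /-- the base of the realified divisor-monoid data ([EtTh] §3 input) -/
  D₀ : Type u₀
  /-- its category structure (objects and morphisms in one universe) -/
  [catD₀ : Category.{u₀} D₀]
  /-- the realified divisor monoids ([EtTh] §3 input, weak [FrdI] vocabulary) -/
  T' : RealifiedDivisorMonoids (D₀ := D₀) treeMonoidVocabWeak.{0}
  /-- the [FrdI] category data over `𝒟_v = CosetCat Π_{X̳̲_v̲}` -/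
  VD : FrdICatStub.{0, 0, 0} T.Dv
  /-- the [EtTh] Def. 3.6 tempered Frobenioid `ℱ̲_v` over `𝒟_v` -/
  Fr : TemperedFrobenioid T' T.Dv VD
  /-- the carrier of `ℱ÷_v` -/
  Fbirat : Type
  /-- its category structure -/
  [catFbirat : Category.{0} Fbirat]
  /-- the remaining tempered-side input over `Fr` (abc-iut-L5-t2 `TemperedThetaRest`) -/
  R : @TemperedThetaRest _ (D.fact_primeAt_prime x (D.not_mem_arc_of_mem_bad hx)) (D.gvdAt x _) _ _ _ T
    (D.qRootAtIdx x hx) (D.qRootAtIdx_not_isUnit x hx) D₀ catD₀ _ T' VD Fr Fbirat catFbirat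

namespace BadTemperedRest

variable {D B} {x : D.IndexCopy} {hx : x ∈ D.indexCopyBad}
  {T : BadLocalGroupDatum (D.GalAt x (D.not_mem_arc_of_mem_bad hx)) ↥(B x hx).H} (Rr : D.BadTemperedRest B x hx T)

/-- **The `TemperedThetaInput`-shaped side of a tempered Frobenioid + rest**: `ℱ̲_v := Fr.category`, `𝒞_v := Fr^{bs-fld}`,
`Kt := R.toInput` (gen 6). ([IUTchI] Ex 3.2 (i)(iii) pp.70-71) [claim: Mochizuki2012, status: disputed] -/
def toSide : D.BadTemperedSide B x hx T :=
  haveI := D.fact_primeAt_prime x (D.not_mem_arc_of_mem_bad hx)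
  letI := Rr.catD₀; letI := Rr.catFbirat
  { Fv := Rr.Fr.category, Fbirat := Rr.Fbirat, Cv := Rr.Fr.hullCategory, Kt := Rr.R.toInput }

/-- Its carriers ARE `ℱ̲_v := Fr.category`, `𝒞_v := Fr^{bs-fld}`. ([IUTchI] Ex 3.2 (i)(iii) pp.70-71) [claim: Mochizuki2012, status: disputed] -/
theorem toSide_Fv : Rr.toSide.Fv = (letI := Rr.catD₀; Rr.Fr.category) ∧ Rr.toSide.Cv = (letI := Rr.catD₀; Rr.Fr.hullCategory) :=
  ⟨rfl, rfl⟩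

end BadTemperedRest

variable (m2 : ∀ x (hx : x ∈ D.indexCopyBad), BadLocalGroupDatum (D.GalAt x (D.not_mem_arc_of_mem_bad hx)) ↥(B x hx).H)
  (Rr : ∀ x (hx : x ∈ D.indexCopyBad), D.BadTemperedRest B x hx (m2 x hx)) (m4 : RealifiedGlobalSide)
  (geomTFG : D.geom.extF.GeomTFG)

/-- **The merge record whose (m1) IS an [EtTh] tempered Frobenioid + rest at every bad index.**
([IUTchI] Ex 3.2 (i) p.70) [claim: Mochizuki2012, status: disputed] -/
def MergeInputs.ofRest : D.MergeInputs B where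
  m2 := m2
  m1 x hx := (Rr x hx).toSide
  m4 := m4
  geomTFG := geomTFG

/-- Its (m1) at `x` is `(Rr x hx).toSide`. ([IUTchI] Ex 3.2 (i) p.70) [claim: Mochizuki2012, status: disputed] -/
theorem MergeInputs.ofRest_m1 (x : D.IndexCopy) (hx : x ∈ D.indexCopyBad) :
    (MergeInputs.ofRest D B m2 Rr m4 geomTFG).m1 x hx = (Rr x hx).toSide := rfl

variable (x : D.IndexCopy) (hx : x ∈ D.indexCopyBad)

/-- **[IUTchI] Ex. 3.2 (iii) AT THE MERGE RECORD with tempered (m1)**: «`𝒞_v ⊆ ℱ̲_v` may be reconstructed category-theoretically from `ℱ̲_v`» —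
`CFromF` — HOLDS at `frobeniusBadAt B (ofRest …) x hx`, modulo abc-iut-L1-t12's [EtTh] Cor. 3.8 (ii) bundle on `Fr` {`hnd`, `hds`, `hF`, `h5`, `hR`}
(p489650 `cFromF_badLocalFrobenioidAt_toInput`, `T := m2 x hx`). ([IUTchI] Ex 3.2 (iii) p.71) [claim: Mochizuki2012, status: disputed] -/
theorem cFromF_frobeniusBadAt_ofRest [Fact (D.primeAt x (D.not_mem_arc_of_mem_bad hx)).Prime]
    (hnd : letI := (Rr x hx).catD₀
      ∀ (A : (m2 x hx).Dvᵒᵖ) (f : A ⟶ A), treeMonoidVocabWeak.{0}.IsNonDilating ((Rr x hx).Fr.Φ.carrier A) ((Rr x hx).Fr.Φ.pull f))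
    (hds : letI := (Rr x hx).catD₀
      ∀ (A : (m2 x hx).Dv) (α : Aut (Over.forget A)),
      (∀ (B' : Over A) (y : (Rr x hx).Fr.divisorMonoid.obj (op B'.left)),
        Literature.AlgebraicGeometry.Frobenioids.pull (Rr x hx).Fr.divisorMonoid (α.hom.app B') y = y) → α = 1)
    (hF : letI := (Rr x hx).catD₀; PreFrobenioid.IsFrobenioid (Rr x hx).Fr.toElem)
    (h5 : letI := (Rr x hx).catD₀; (Rr x hx).Fr.BsFldPreStepLimitCriterion (PreFrobenioidData.perfection hF))
    (hR : letI := (Rr x hx).catD₀; (Rr x hx).Fr.Remark363) :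
    (D.frobeniusBadAt B (MergeInputs.ofRest D B m2 Rr m4 geomTFG) x hx).CFromF :=
  haveI := D.liesOver_placeBelow x hx
  haveI := D.isScalarTower
  letI := (Rr x hx).catD₀; letI := (Rr x hx).catFbirat
  D.cFromF_badLocalFrobenioidAt_toInput (D.placeBelow_mem_VFbad x hx) (D.specAt x _) (D.primeAt x _) (D.primeAt_mem x _)
    (m2 x hx) (Rr x hx).Fr (Rr x hx).R hnd hds hF h5 hR

/-- **[IUTchI] Ex. 3.2 (vi)(d) AT THE MERGE RECORD with tempered (m1)**, both halves — `DFromF` — modulo the [FrdI] Thm. 3.4 (v) bundles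
{`hF′`, `hC`} and {`Π_{X̳̲_v̲}` tempered `hP`, slim `hZ`} (p489650 `dFromF_badLocalFrobenioidAt_toInput_of_isTempered`, `T := m2 x hx`).
([IUTchI] Ex 3.2 (vi) (d) p.73) [claim: Mochizuki2012, status: disputed] -/
theorem dFromF_frobeniusBadAt_ofRest [Fact (D.primeAt x (D.not_mem_arc_of_mem_bad hx)).Prime]
    (hF' : letI := (Rr x hx).catD₀
      ∀ e : (Rr x hx).Fr.category ≌ (Rr x hx).Fr.category, FrdI.Thm34Sub.StdHyp (Rr x hx).Fr.toElem (Rr x hx).Fr.toElem e)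
    (hC : letI := (Rr x hx).catD₀
      ∀ e : (Rr x hx).Fr.hullCategory ≌ (Rr x hx).Fr.hullCategory,
      FrdI.Thm34Sub.StdHyp (ModelFrobenioid.toElem (Rr x hx).Fr.bsFldMonoid (Rr x hx).Fr.cnstFnBsFunctor (Rr x hx).Fr.divFNatTrans)
        (ModelFrobenioid.toElem (Rr x hx).Fr.bsFldMonoid (Rr x hx).Fr.cnstFnBsFunctor (Rr x hx).Fr.divFNatTrans) e)
    (hP : IsTempered ↥(B x hx).H) (hZ : IsSlimGroup ↥(B x hx).H) :
    (D.frobeniusBadAt B (MergeInputs.ofRest D B m2 Rr m4 geomTFG) x hx).DFromF :=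
  haveI := D.liesOver_placeBelow x hx
  haveI := D.isScalarTower
  letI := (Rr x hx).catD₀; letI := (Rr x hx).catFbirat
  D.dFromF_badLocalFrobenioidAt_toInput_of_isTempered (D.placeBelow_mem_VFbad x hx) (D.specAt x _) (D.primeAt x _)
    (D.primeAt_mem x _) (m2 x hx) (Rr x hx).Fr (Rr x hx).R hF' hC hP hZ

/-- **(vi)(d) at the merge record with tempered (m1) for a CLOSED avatar** (`hP` discharged by [SemiAnbd] Rmk. 3.1.1), modulo {`hF′`, `hC`, `hZ`}.
([IUTchI] Ex 3.2 (vi) (d) p.73) [claim: Mochizuki2012, status: disputed] -/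
theorem dFromF_frobeniusBadAt_ofRest_of_isClosed [Fact (D.primeAt x (D.not_mem_arc_of_mem_bad hx)).Prime]
    (hH : IsClosed ((B x hx).H : Set D.PiC))
    (hF' : letI := (Rr x hx).catD₀
      ∀ e : (Rr x hx).Fr.category ≌ (Rr x hx).Fr.category, FrdI.Thm34Sub.StdHyp (Rr x hx).Fr.toElem (Rr x hx).Fr.toElem e)
    (hC : letI := (Rr x hx).catD₀
      ∀ e : (Rr x hx).Fr.hullCategory ≌ (Rr x hx).Fr.hullCategory,
      FrdI.Thm34Sub.StdHyp (ModelFrobenioid.toElem (Rr x hx).Fr.bsFldMonoid (Rr x hx).Fr.cnstFnBsFunctor (Rr x hx).Fr.divFNatTrans)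
        (ModelFrobenioid.toElem (Rr x hx).Fr.bsFldMonoid (Rr x hx).Fr.cnstFnBsFunctor (Rr x hx).Fr.divFNatTrans) e)
    (hZ : IsSlimGroup ↥(B x hx).H) :
    (D.frobeniusBadAt B (MergeInputs.ofRest D B m2 Rr m4 geomTFG) x hx).DFromF :=
  D.dFromF_frobeniusBadAt_ofRest B m2 Rr m4 geomTFG x hx hF' hC (D.isTempered_badPair_of_isClosed B x hx hH) hZ

/-- **[IUTchI] Ex. 3.2 (iii) ∧ (vi)(c) ∧ (vi)(d) JOINTLY at the merge record with tempered (m1)**, for a closed avatar: (vi)(c) UNCONDITIONAL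
(p497246 `basesFromC_frobeniusBadAt`), (iii) mod the [EtTh] Cor. 3.8 (ii) bundle, (vi)(d) mod {`hF′`, `hC`, `hZ`}.
([IUTchI] Ex 3.2 (vi) p.73) [claim: Mochizuki2012, status: disputed] -/
theorem ex32_iii_vi_cd_frobeniusBadAt_ofRest [Fact (D.primeAt x (D.not_mem_arc_of_mem_bad hx)).Prime]
    (hH : IsClosed ((B x hx).H : Set D.PiC))
    (hnd : letI := (Rr x hx).catD₀
      ∀ (A : (m2 x hx).Dvᵒᵖ) (f : A ⟶ A), treeMonoidVocabWeak.{0}.IsNonDilating ((Rr x hx).Fr.Φ.carrier A) ((Rr x hx).Fr.Φ.pull f))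
    (hds : letI := (Rr x hx).catD₀
      ∀ (A : (m2 x hx).Dv) (α : Aut (Over.forget A)),
      (∀ (B' : Over A) (y : (Rr x hx).Fr.divisorMonoid.obj (op B'.left)),
        Literature.AlgebraicGeometry.Frobenioids.pull (Rr x hx).Fr.divisorMonoid (α.hom.app B') y = y) → α = 1)
    (hF : letI := (Rr x hx).catD₀; PreFrobenioid.IsFrobenioid (Rr x hx).Fr.toElem)
    (h5 : letI := (Rr x hx).catD₀; (Rr x hx).Fr.BsFldPreStepLimitCriterion (PreFrobenioidData.perfection hF))
    (hR : letI := (Rr x hx).catD₀; (Rr x hx).Fr.Remark363)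
    (hF' : letI := (Rr x hx).catD₀
      ∀ e : (Rr x hx).Fr.category ≌ (Rr x hx).Fr.category, FrdI.Thm34Sub.StdHyp (Rr x hx).Fr.toElem (Rr x hx).Fr.toElem e)
    (hC : letI := (Rr x hx).catD₀
      ∀ e : (Rr x hx).Fr.hullCategory ≌ (Rr x hx).Fr.hullCategory,
      FrdI.Thm34Sub.StdHyp (ModelFrobenioid.toElem (Rr x hx).Fr.bsFldMonoid (Rr x hx).Fr.cnstFnBsFunctor (Rr x hx).Fr.divFNatTrans)
        (ModelFrobenioid.toElem (Rr x hx).Fr.bsFldMonoid (Rr x hx).Fr.cnstFnBsFunctor (Rr x hx).Fr.divFNatTrans) e)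
    (hZ : IsSlimGroup ↥(B x hx).H) :
    (D.frobeniusBadAt B (MergeInputs.ofRest D B m2 Rr m4 geomTFG) x hx).CFromF ∧
      (D.frobeniusBadAt B (MergeInputs.ofRest D B m2 Rr m4 geomTFG) x hx).BasesFromC ∧
      (D.frobeniusBadAt B (MergeInputs.ofRest D B m2 Rr m4 geomTFG) x hx).DFromF :=
  ⟨D.cFromF_frobeniusBadAt_ofRest B m2 Rr m4 geomTFG x hx hnd hds hF h5 hR,
    D.basesFromC_frobeniusBadAt B _ x hx,
    D.dFromF_frobeniusBadAt_ofRest_of_isClosed B m2 Rr m4 geomTFG x hx hH hF' hC hZ⟩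

end InitialThetaData

end Literature.IUT.HodgeTheaters

end
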